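import Mathlib.Analysis.SpecialFunctions.Exp
import Mathlib.Data.Fintype.BigOperators
import Mathlib.Logic.Function.Basic
import Mathlib.Tactic.FinCases
import HarnessLib

/-!
# Crux `NonSimplyConnectedLatticeGap` (stmt-QuantumFields-16405), route `ConvexGribovBody`,
# line `twist-equipartition-blindness` — stub `stub_sectorMixture` (MIX), auxiliary layer 1

Pure real-variable bookkeeping for the sector mixture step (no measure theory):

* `mix_cross_term_bound`, `mix_none_term_bound`, `mix_pair_trivial_bound` — the three elementary
  junk-safe estimates (`p⁻¹` is Lean's total inverse, `0⁻¹ = 0`) of the terms of the law of total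
  covariance over the flux sectors;
* `mix_blind_comp` — chaining of sector blindness along one intermediate sector `v`, from the exact
  identity `p_v D(z,w) = p_w D(z,v) + p_z D(v,w)`, `D(x,y) = p_y a_x − p_x a_y`;
* `mix_bound_abstract` — the bound of the right-hand side of the sector identity
  (`stub_sectorIdentity`) by `ε + ½ δ_A δ_B + 6 M_A M_B p_none`;
* `mix_path` — any two flux labels `z w : planes → Z` are joined by one electric step (all planes
  through the time axis at once) and three single magnetic-plane steps;
* `mix_rate_bounds` (registered sub-goal) — the exponent bookkeeping
  `e^{−mn}, e^{−2μ(2S+1)}, e^{−cS} ≤ e^{−m'n}` for `n ≤ S`, `m' = min m (min 2μ c)` (this is where the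
  time bound `n ≤ S` of the crux is used).
-/

set_option autoImplicit false

namespace Summit.QuantumFields.YangMills.Theorems.NonSimplyConnectedLatticeGap

open Finset


/-- Junk-safe cross-term estimate: if `|x| ≤ α p q` and `|y| ≤ β p q` with `p, q, α ≥ 0` then
`|p⁻¹ q⁻¹ x y| ≤ α β p q` (both sides vanish when `p q = 0`). -/
theorem mix_cross_term_bound (p q x y α β : ℝ) (hp : 0 ≤ p) (hq : 0 ≤ q) (hα : 0 ≤ α)
    (hx : |x| ≤ α * (p * q)) (hy : |y| ≤ β * (p * q)) :
    |p⁻¹ * q⁻¹ * x * y| ≤ α * β * (p * q) := by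
  rcases hp.eq_or_lt with h | hp'
  · subst h
    have hx0 : x = 0 := by simpa using hx
    simp [hx0]
  rcases hq.eq_or_lt with h | hq'
  · subst h
    have hx0 : x = 0 := by simpa using hx
    simp [hx0]
  have hpq : 0 < p * q := mul_pos hp' hq'
  have key : |x| * |y| ≤ (α * (p * q)) * (β * (p * q)) :=
    mul_le_mul hx hy (abs_nonneg _) (mul_nonneg hα hpq.le)
  calc |p⁻¹ * q⁻¹ * x * y| = (p * q)⁻¹ * (|x| * |y|) := by
        rw [abs_mul, abs_mul, abs_mul, abs_inv, abs_inv, abs_of_pos hp', abs_of_pos hq', mul_inv]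
        ring
    _ ≤ (p * q)⁻¹ * ((α * (p * q)) * (β * (p * q))) :=
        mul_le_mul_of_nonneg_left key (inv_nonneg.2 hpq.le)
    _ = α * β * (p * q) := by
        field_simp

/-- Junk-safe estimate of the unlabelled (bad-event) term: `|c − p⁻¹ a b| ≤ 2 M N p` if
`|a| ≤ M p`, `|b| ≤ N p`, `|c| ≤ M N p`. -/
theorem mix_none_term_bound (p a b c M N : ℝ) (hp : 0 ≤ p) (hM : 0 ≤ M)
    (ha : |a| ≤ M * p) (hb : |b| ≤ N * p) (hc : |c| ≤ M * N * p) :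
    |c - p⁻¹ * a * b| ≤ 2 * (M * N * p) := by
  have h2 : |p⁻¹ * a * b| ≤ M * N * p := by
    rcases hp.eq_or_lt with h | hp'
    · subst h
      simp
    rw [abs_mul, abs_mul, abs_inv, abs_of_pos hp']
    calc p⁻¹ * |a| * |b| = p⁻¹ * (|a| * |b|) := by ring
      _ ≤ p⁻¹ * ((M * p) * (N * p)) :=
          mul_le_mul_of_nonneg_left (mul_le_mul ha hb (abs_nonneg _) (mul_nonneg hM hp))
            (inv_nonneg.2 hp)
      _ = M * N * p := by
          field_simp
  calc |c - p⁻¹ * a * b| ≤ |c| + |p⁻¹ * a * b| := abs_sub _ _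
    _ ≤ M * N * p + M * N * p := add_le_add hc h2
    _ = 2 * (M * N * p) := by ring

/-- The trivial blindness estimate: `|q a − p a'| ≤ 2 M p q` if `|a| ≤ M p`, `|a'| ≤ M q`. -/
theorem mix_pair_trivial_bound (p q a a' M : ℝ) (hp : 0 ≤ p) (hq : 0 ≤ q)
    (ha : |a| ≤ M * p) (ha' : |a'| ≤ M * q) : |q * a - p * a'| ≤ 2 * M * (p * q) := by
  calc |q * a - p * a'| ≤ |q * a| + |p * a'| := abs_sub _ _
    _ = q * |a| + p * |a'| := by rw [abs_mul, abs_mul, abs_of_nonneg hq, abs_of_nonneg hp]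
    _ ≤ q * (M * p) + p * (M * q) :=
        add_le_add (mul_le_mul_of_nonneg_left ha hq) (mul_le_mul_of_nonneg_left ha' hp)
    _ = 2 * M * (p * q) := by ring

/-- **Chaining blindness through one intermediate sector.** If `D(x,y) = p_y a_x − p_x a_y` is
bounded by `C η p_x p_y` on `R`-pairs and by `C' η p_x p_y` on `R'`-pairs, null sectors carry no
integral and `R'` transports nullity, then `D` is bounded by `(C + C') η p_z p_w` on `R ∘ R'`-pairs
(exact identity `p_v D(z,w) = p_w D(z,v) + p_z D(v,w)`; if `p_v = 0` both sides vanish). -/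
theorem mix_blind_comp {K : Type*} (R R' : K → K → Prop) (p a : K → ℝ) (η C C' : ℝ)
    (hp : ∀ k, 0 ≤ p k) (h0 : ∀ k, p k = 0 → a k = 0)
    (hR' : ∀ v w, R' v w → p v = 0 → p w = 0)
    (hD : ∀ z w, R z w → |p w * a z - p z * a w| ≤ C * η * (p z * p w))
    (hD' : ∀ z w, R' z w → |p w * a z - p z * a w| ≤ C' * η * (p z * p w)) :
    ∀ z v w, R z v → R' v w → |p w * a z - p z * a w| ≤ (C + C') * η * (p z * p w) := by
  intro z v w hzv hvw
  rcases (hp v).eq_or_lt with hv | hv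
  · have hw : p w = 0 := hR' v w hvw hv.symm
    have haw : a w = 0 := h0 w hw
    simp [hw, haw]
  · have key : p v * (p w * a z - p z * a w)
        = p w * (p v * a z - p z * a v) + p z * (p w * a v - p v * a w) := by ring
    have H : |p v * (p w * a z - p z * a w)| ≤ p v * ((C + C') * η * (p z * p w)) := by
      rw [key]
      calc |p w * (p v * a z - p z * a v) + p z * (p w * a v - p v * a w)|
          ≤ |p w * (p v * a z - p z * a v)| + |p z * (p w * a v - p v * a w)| := abs_add_le _ _
        _ = p w * |p v * a z - p z * a v| + p z * |p w * a v - p v * a w| := by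
            rw [abs_mul, abs_mul, abs_of_nonneg (hp w), abs_of_nonneg (hp z)]
        _ ≤ p w * (C * η * (p z * p v)) + p z * (C' * η * (p v * p w)) :=
            add_le_add (mul_le_mul_of_nonneg_left (hD z v hzv) (hp w))
              (mul_le_mul_of_nonneg_left (hD' v w hvw) (hp z))
        _ = p v * ((C + C') * η * (p z * p w)) := by ring
    rw [abs_mul, abs_of_pos hv] at H
    exact le_of_mul_le_mul_left H hv

/-- **Bound of the right-hand side of the sector identity.** Over the labels `Option K` (`none` =
the bad event) with weights `p ≥ 0`, `Σ p = 1`, sector integrals `a, b, c` of `A`, `B`, `A·B`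
bounded by `M_A p`, `M_B p`, `M_A M_B p`, per-sector clustering `ε` on labelled sectors and
blindness `δ_A`, `δ_B` on labelled pairs:
`|Σ_k (c_k − p_k⁻¹ a_k b_k) + ½ Σ_{k,k'} p_k⁻¹ p_{k'}⁻¹ D_{kk'}(a) D_{kk'}(b)| ≤ ε + ½ δ_A δ_B + 6 M_A M_B p_none`. -/
theorem mix_bound_abstract {K : Type*} [Fintype K] (p a b c : Option K → ℝ) (MA MB ε δA δB : ℝ)
    (hp0 : ∀ o, 0 ≤ p o) (hp1 : ∑ o, p o = 1) (hMA : 0 ≤ MA) (hMB : 0 ≤ MB) (hε : 0 ≤ ε)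
    (hδA : 0 ≤ δA) (hδB : 0 ≤ δB)
    (ha : ∀ o, |a o| ≤ MA * p o) (hb : ∀ o, |b o| ≤ MB * p o) (hc : ∀ o, |c o| ≤ MA * MB * p o)
    (hpsc : ∀ z : K, |c (some z) - (p (some z))⁻¹ * a (some z) * b (some z)| ≤ ε * p (some z))
    (hA : ∀ z w : K, |p (some w) * a (some z) - p (some z) * a (some w)|
      ≤ δA * (p (some z) * p (some w)))
    (hB : ∀ z w : K, |p (some w) * b (some z) - p (some z) * b (some w)|
      ≤ δB * (p (some z) * p (some w))) :
    |(∑ k, (c k - (p k)⁻¹ * a k * b k))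
        + (1 / 2) * ∑ k, ∑ k', (p k)⁻¹ * (p k')⁻¹ * ((p k' * a k) - p k * a k')
            * ((p k' * b k) - p k * b k')|
      ≤ ε + (1 / 2) * (δA * δB) + 6 * (MA * MB * p none) := by
  have hsum : ∑ z : K, p (some z) ≤ 1 := by
    have h := hp1
    rw [Fintype.sum_option] at h
    linarith [hp0 none]
  have hsum0 : 0 ≤ ∑ z : K, p (some z) := Finset.sum_nonneg fun z _ => hp0 _
  -- the per-sector terms
  have h1 : ∑ k, |c k - (p k)⁻¹ * a k * b k| ≤ 2 * (MA * MB * p none) + ε := by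
    rw [Fintype.sum_option]
    refine add_le_add (mix_none_term_bound _ _ _ _ _ _ (hp0 _) hMA (ha _) (hb _) (hc _)) ?_
    calc ∑ z : K, |c (some z) - (p (some z))⁻¹ * a (some z) * b (some z)|
        ≤ ∑ z : K, ε * p (some z) := Finset.sum_le_sum fun z _ => hpsc z
      _ = ε * ∑ z : K, p (some z) := (Finset.mul_sum _ _ _).symm
      _ ≤ ε := mul_le_of_le_one_right hε hsum
  -- the cross terms
  have hYns : ∀ w : K, |(p none)⁻¹ * (p (some w))⁻¹ * ((p (some w) * a none) - p none * a (some w))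
      * ((p (some w) * b none) - p none * b (some w))| ≤ 2 * MA * (2 * MB) * (p none * p (some w)) :=
    fun w => mix_cross_term_bound _ _ _ _ _ _ (hp0 _) (hp0 _) (by positivity)
      (mix_pair_trivial_bound _ _ _ _ _ (hp0 _) (hp0 _) (ha _) (ha _))
      (mix_pair_trivial_bound _ _ _ _ _ (hp0 _) (hp0 _) (hb _) (hb _))
  have hYsn : ∀ z : K, |(p (some z))⁻¹ * (p none)⁻¹ * ((p none * a (some z)) - p (some z) * a none)
      * ((p none * b (some z)) - p (some z) * b none)| ≤ 2 * MA * (2 * MB) * (p (some z) * p none) :=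
    fun z => mix_cross_term_bound _ _ _ _ _ _ (hp0 _) (hp0 _) (by positivity)
      (mix_pair_trivial_bound _ _ _ _ _ (hp0 _) (hp0 _) (ha _) (ha _))
      (mix_pair_trivial_bound _ _ _ _ _ (hp0 _) (hp0 _) (hb _) (hb _))
  have hYss : ∀ z w : K, |(p (some z))⁻¹ * (p (some w))⁻¹
      * ((p (some w) * a (some z)) - p (some z) * a (some w))
      * ((p (some w) * b (some z)) - p (some z) * b (some w))| ≤ δA * δB * (p (some z) * p (some w)) :=
    fun z w => mix_cross_term_bound _ _ _ _ _ _ (hp0 _) (hp0 _) hδA (hA z w) (hB z w)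
  have h2 : ∑ k, ∑ k', |(p k)⁻¹ * (p k')⁻¹ * ((p k' * a k) - p k * a k') * ((p k' * b k) - p k * b k')|
      ≤ 8 * (MA * MB * p none) + δA * δB := by
    simp only [Fintype.sum_option, sub_self, mul_zero, abs_zero, zero_add,
      Finset.sum_add_distrib]
    have e1 : ∑ w : K, |(p none)⁻¹ * (p (some w))⁻¹ * ((p (some w) * a none) - p none * a (some w))
        * ((p (some w) * b none) - p none * b (some w))| ≤ 4 * (MA * MB * p none) := by
      calc _ ≤ ∑ w : K, 2 * MA * (2 * MB) * (p none * p (some w)) := Finset.sum_le_sum fun w _ => hYns w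
        _ = 4 * (MA * MB * p none) * ∑ w : K, p (some w) := by
            rw [Finset.mul_sum]
            refine Finset.sum_congr rfl fun w _ => ?_
            ring
        _ ≤ 4 * (MA * MB * p none) :=
            mul_le_of_le_one_right (by have := hp0 none; positivity) hsum
    have e2 : ∑ z : K, |(p (some z))⁻¹ * (p none)⁻¹ * ((p none * a (some z)) - p (some z) * a none)
        * ((p none * b (some z)) - p (some z) * b none)| ≤ 4 * (MA * MB * p none) := by
      calc _ ≤ ∑ z : K, 2 * MA * (2 * MB) * (p (some z) * p none) := Finset.sum_le_sum fun z _ => hYsn z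
        _ = 4 * (MA * MB * p none) * ∑ z : K, p (some z) := by
            rw [Finset.mul_sum]
            refine Finset.sum_congr rfl fun z _ => ?_
            ring
        _ ≤ 4 * (MA * MB * p none) :=
            mul_le_of_le_one_right (by have := hp0 none; positivity) hsum
    have e3 : ∑ z : K, ∑ w : K, |(p (some z))⁻¹ * (p (some w))⁻¹
        * ((p (some w) * a (some z)) - p (some z) * a (some w))
        * ((p (some w) * b (some z)) - p (some z) * b (some w))| ≤ δA * δB := by
      calc _ ≤ ∑ z : K, ∑ w : K, δA * δB * (p (some z) * p (some w)) :=
            Finset.sum_le_sum fun z _ => Finset.sum_le_sum fun w _ => hYss z w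
        _ = δA * δB * ((∑ z : K, p (some z)) * ∑ w : K, p (some w)) := by
            rw [Finset.sum_mul_sum, Finset.mul_sum]
            refine Finset.sum_congr rfl fun z _ => ?_
            rw [Finset.mul_sum]
        _ ≤ δA * δB * 1 :=
            mul_le_mul_of_nonneg_left (mul_le_one₀ hsum hsum0 hsum) (mul_nonneg hδA hδB)
        _ = δA * δB := mul_one _
    linarith [e1, e2, e3]
  -- assemble
  calc |(∑ k, (c k - (p k)⁻¹ * a k * b k))
        + (1 / 2) * ∑ k, ∑ k', (p k)⁻¹ * (p k')⁻¹ * ((p k' * a k) - p k * a k')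
            * ((p k' * b k) - p k * b k')|
      ≤ |∑ k, (c k - (p k)⁻¹ * a k * b k)|
        + |(1 / 2) * ∑ k, ∑ k', (p k)⁻¹ * (p k')⁻¹ * ((p k' * a k) - p k * a k')
            * ((p k' * b k) - p k * b k')| := abs_add_le _ _
    _ ≤ (∑ k, |c k - (p k)⁻¹ * a k * b k|)
        + (1 / 2) * ∑ k, ∑ k', |(p k)⁻¹ * (p k')⁻¹ * ((p k' * a k) - p k * a k')
            * ((p k' * b k) - p k * b k')| := by
        refine add_le_add (Finset.abs_sum_le_sum_abs _ _) ?_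
        rw [abs_mul, abs_of_pos (by norm_num : (0 : ℝ) < 1 / 2)]
        refine mul_le_mul_of_nonneg_left ?_ (by norm_num)
        exact (Finset.abs_sum_le_sum_abs _ _).trans
          (Finset.sum_le_sum fun k _ => Finset.abs_sum_le_sum_abs _ _)
    _ ≤ (2 * (MA * MB * p none) + ε) + (1 / 2) * (8 * (MA * MB * p none) + δA * δB) :=
        add_le_add h1 (mul_le_mul_of_nonneg_left h2 (by norm_num))
    _ = ε + (1 / 2) * (δA * δB) + 6 * (MA * MB * p none) := by ring

/-- **Paths in the flux lattice.** Any two labels `z w : planes → Z` of the `4`-torus are joined by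
one ELECTRIC step (change all planes `(0, j)` through the time axis at once, keeping the magnetic
planes) followed by three single-plane steps at the magnetic planes `(1,2)`, `(1,3)`, `(2,3)`. -/
theorem mix_path {Z : Type*} (z w : {p : Fin 4 × Fin 4 // p.1 < p.2} → Z) :
    ∃ v₁ v₂ v₃ : {p : Fin 4 × Fin 4 // p.1 < p.2} → Z,
      (∀ q : {p : Fin 4 × Fin 4 // p.1 < p.2}, q.1.1 ≠ 0 → z q = v₁ q) ∧
      (∀ q' : {p : Fin 4 × Fin 4 // p.1 < p.2},
        q' ≠ (⟨((1 : Fin 4), (2 : Fin 4)), by decide⟩ : {p : Fin 4 × Fin 4 // p.1 < p.2}) →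
          v₁ q' = v₂ q') ∧
      (∀ q' : {p : Fin 4 × Fin 4 // p.1 < p.2},
        q' ≠ (⟨((1 : Fin 4), (3 : Fin 4)), by decide⟩ : {p : Fin 4 × Fin 4 // p.1 < p.2}) →
          v₂ q' = v₃ q') ∧
      (∀ q' : {p : Fin 4 × Fin 4 // p.1 < p.2},
        q' ≠ (⟨((2 : Fin 4), (3 : Fin 4)), by decide⟩ : {p : Fin 4 × Fin 4 // p.1 < p.2}) →
          v₃ q' = w q') := by
  classical
  refine ⟨fun q => if q.1.1 = 0 then w q else z q,
    Function.update (fun q => if q.1.1 = 0 then w q else z q)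
      (⟨((1 : Fin 4), (2 : Fin 4)), by decide⟩ : {p : Fin 4 × Fin 4 // p.1 < p.2})
      (w ⟨((1 : Fin 4), (2 : Fin 4)), by decide⟩),
    Function.update (Function.update (fun q => if q.1.1 = 0 then w q else z q)
      (⟨((1 : Fin 4), (2 : Fin 4)), by decide⟩ : {p : Fin 4 × Fin 4 // p.1 < p.2})
      (w ⟨((1 : Fin 4), (2 : Fin 4)), by decide⟩))
      (⟨((1 : Fin 4), (3 : Fin 4)), by decide⟩ : {p : Fin 4 × Fin 4 // p.1 < p.2})
      (w ⟨((1 : Fin 4), (3 : Fin 4)), by decide⟩), ?_, ?_, ?_, ?_⟩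
  · intro q hq
    simp [hq]
  · intro q' hq'
    rw [Function.update_of_ne hq']
  · intro q' hq'
    rw [Function.update_of_ne hq']
  · intro q' hq'
    obtain ⟨⟨i, j⟩, hij⟩ := q'
    fin_cases i <;> fin_cases j <;>
      first
        | exact absurd hij (by decide)
        | simp_all (config := { decide := true })

/-- **Exponent bookkeeping** (the one place where the time bound `n ≤ S` is used): with
`m' = min m (min (2μ) c)`, for `n ≤ S`, `e^{−mn} ≤ e^{−m'n}`, `e^{−μ(2S+1)} e^{−μ(2S+1)} ≤ e^{−m'n}` and
`e^{−cS} ≤ e^{−m'n}`. -/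
theorem mix_rate_bounds : ∀ (m μ c : ℝ), 0 < μ → 0 < c → ∀ (S n : ℕ), n ≤ S → Real.exp (-(m * n)) ≤ Real.exp (-(min m (min (2 * μ) c) * n)) ∧ Real.exp (-(μ * (2 * (S : ℝ) + 1))) * Real.exp (-(μ * (2 * (S : ℝ) + 1))) ≤ Real.exp (-(min m (min (2 * μ) c) * n)) ∧ Real.exp (-(c * S)) ≤ Real.exp (-(min m (min (2 * μ) c) * n)) := by
  intro m μ c hμ hc S n hn
  have hnS : (n : ℝ) ≤ S := by exact_mod_cast hn
  have hn0 : (0 : ℝ) ≤ n := n.cast_nonneg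
  have h1 : min m (min (2 * μ) c) ≤ m := min_le_left _ _
  have h2 : min m (min (2 * μ) c) ≤ 2 * μ := (min_le_right _ _).trans (min_le_left _ _)
  have h3 : min m (min (2 * μ) c) ≤ c := (min_le_right _ _).trans (min_le_right _ _)
  refine ⟨Real.exp_le_exp.2 ?_, ?_, Real.exp_le_exp.2 ?_⟩
  · nlinarith
  · rw [← Real.exp_add]
    refine Real.exp_le_exp.2 ?_
    nlinarith
  · nlinarith


end Summit.QuantumFields.YangMills.Theorems.NonSimplyConnectedLatticeGap
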